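import Literature.NumberTheory.Automorphic.UnitaryInfinityType
import Literature.NumberTheory.GaloisRepresentations.HeckeCharacterArchType
import HarnessLib

/-!
# Unitary idele class characters as Hecke characters; ∞-type = unitary archimedean type `(e, 0)`

Topic `NumberTheory/Automorphic`; namespace `Literature.NumberTheory.Automorphic` (grouping sub-namespace
`IdeleClassGroup`). **No named facts, no `sorry`.**

The tree carries two languages for unitary Hecke characters with prescribed archimedean behaviour:

* `Automorphic/UnitaryInfinityType`: continuous `ψ : C_K →ₜ* S¹` with `IdeleClassGroup.HasInfinityType K ψ e`
  (`ψ|_{K_∞ˣ} = infinityTypeChar e = ∏_v (u_v/‖u_v‖)^{e_v}`), the output type of the existence theorems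
  `exists_ideleClassChar_of_infinityType` / `…_of_isProperMap'` (Weil BNT VII §3);
* `GaloisRepresentations/HeckeCharacterArchType`: `χ : HeckeCharacter K` (continuous `𝕀_K →* ℂˣ` trivial
  on `Kˣ`) with `χ.IsUnitary ∧ χ.HasUnitaryArchType m t` (Patrikis 2019 §2.1), the language of
  `HeckeCharacter.exists_of_unitaryArchParams_iff`.

This file is the dictionary: `IdeleClassGroup.toHeckeCharacter K ψ := HeckeCharacter.ofIdeleClassCharacter
(circleToUnits ∘ ψ)` is unitary (`isUnitary_toHeckeCharacter`), evaluates as `χ x = ψ [x]`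
(`coe_toHeckeCharacter_apply`), and `χ.HasUnitaryArchType e 0 ↔ HasInfinityType K ψ e`
(`hasUnitaryArchType_toHeckeCharacter_iff`; via the tree bridge `coe_infinityTypeChar_eq_unitaryArchChar`).
Hence every existence statement in the first language yields one in the second
(`exists_heckeCharacter_of_hasInfinityType`).

## References

* A. Weil, *Basic Number Theory* (1967), Ch. VII §3. [WeilBNT1967]
* S. Patrikis, *Variations on a theorem of Tate*, Mem. AMS 258 (2019), §2.1. [Patrikis2019]
-/

noncomputable section

open NumberField

namespace Literature.NumberTheory.Automorphic

open GaloisRepresentations (HeckeCharacter ideleGroup infiniteIdeles archUnitaryValue)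

/-- The inclusion `S¹ ↪ ℂˣ` as a continuous monoid hom. [folklore] -/
def circleToUnits : Circle →ₜ* ℂˣ where
  toMonoidHom := Circle.toUnits
  continuous_toFun := by
    refine Units.continuous_iff.mpr ⟨?_, ?_⟩
    · exact continuous_subtype_val
    · change Continuous fun z : Circle => ((Circle.toUnits z)⁻¹ : ℂˣ).val
      simp_rw [← map_inv]
      exact continuous_subtype_val.comp continuous_inv

/-- `circleToUnits z = z` in `ℂ`. [folklore] -/
@[simp] theorem coe_circleToUnits (z : Circle) : ((circleToUnits z : ℂˣ) : ℂ) = z := rfl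

namespace IdeleClassGroup

variable (K : Type) [Field K] [NumberField K]

/-- A continuous unitary character `ψ : C_K → S¹` as a Hecke character `𝕀_K → ℂˣ` (trivial on `Kˣ`).
[cite: WeilBNT1967, Ch. VII §3] -/
def toHeckeCharacter (ψ : IdeleClassGroup K →ₜ* Circle) : HeckeCharacter K :=
  HeckeCharacter.ofIdeleClassCharacter (circleToUnits.comp ψ)

/-- Evaluation: `toHeckeCharacter ψ x = ψ [x]`. [folklore] -/
@[simp] theorem coe_toHeckeCharacter_apply (ψ : IdeleClassGroup K →ₜ* Circle) (x : ideleGroup K) :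
    ((toHeckeCharacter K ψ x : ℂˣ) : ℂ) = ψ (x : IdeleClassGroup K) := rfl

/-- `toHeckeCharacter ψ` is unitary. [folklore] -/
theorem isUnitary_toHeckeCharacter (ψ : IdeleClassGroup K →ₜ* Circle) :
    (toHeckeCharacter K ψ).IsUnitary := fun x => by
  rw [coe_toHeckeCharacter_apply]
  exact Circle.norm_coe _

/-- The descended idele class character of `toHeckeCharacter ψ` is `ψ` (viewed in `ℂˣ`). [folklore] -/
theorem toIdeleClassCharacter_toHeckeCharacter (ψ : IdeleClassGroup K →ₜ* Circle) :
    (toHeckeCharacter K ψ).toIdeleClassCharacter = circleToUnits.comp ψ :=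
  (HeckeCharacter.equivIdeleClassCharacter K).apply_symm_apply _

/-- `toHeckeCharacter` is injective. [folklore] -/
theorem toHeckeCharacter_injective : Function.Injective (toHeckeCharacter K) := by
  intro ψ ψ' h
  refine ContinuousMonoidHom.ext fun c => ?_
  induction c using QuotientGroup.induction_on with
  | H x =>
    have := congrArg (fun χ : HeckeCharacter K => ((χ x : ℂˣ) : ℂ)) h
    simp only [coe_toHeckeCharacter_apply] at this
    exact Circle.ext this

/-- The tree's `unitaryArchChar m t` is the product of the `archUnitaryValue (m w) (t w)`. [folklore] -/
theorem unitaryArchChar_eq_prod_archUnitaryValue (m : InfinitePlace K → ℤ) (t : InfinitePlace K → ℝ)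
    (x : (InfiniteAdeleRing K)ˣ) :
    GaloisRepresentations.InfiniteIdele.unitaryArchChar m t x =
      ∏ w : InfinitePlace K, archUnitaryValue (m w) (t w)
        (InfinitePlace.Completion.extensionEmbedding w ((x : InfiniteAdeleRing K) w)) :=
  rfl

/-- **Dictionary of ∞-types**: `toHeckeCharacter ψ` has unitary archimedean type `(e, 0)` iff `ψ` has
∞-type `e`. [cite: WeilBNT1967, Ch. VII §3] [cite: Patrikis2019, §2.1] -/
theorem hasUnitaryArchType_toHeckeCharacter_iff (ψ : IdeleClassGroup K →ₜ* Circle)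
    (e : InfinitePlace K → ℤ) :
    (toHeckeCharacter K ψ).HasUnitaryArchType e 0 ↔ HasInfinityType K ψ e := by
  unfold HeckeCharacter.HasUnitaryArchType HasInfinityType
  refine forall_congr' fun u => ?_
  rw [coe_toHeckeCharacter_apply, ← unitaryArchChar_eq_prod_archUnitaryValue,
    ← coe_infinityTypeChar_eq_unitaryArchChar, ← infUnitsToClass_apply]
  exact ⟨fun h => Circle.ext h, fun h => congrArg _ h⟩

/-- **Transfer of existence statements.** A unitary idele class character of ∞-type `e` with prescribed
values on a set gives a unitary Hecke character of unitary archimedean type `(e, 0)` with the same values.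
[folklore] -/
theorem exists_heckeCharacter_of_hasInfinityType {ψ : IdeleClassGroup K →ₜ* Circle}
    {e : InfinitePlace K → ℤ} (hψ : HasInfinityType K ψ e) :
    ∃ χ : HeckeCharacter K, χ.IsUnitary ∧ χ.HasUnitaryArchType e 0 ∧
      ∀ x : ideleGroup K, ((χ x : ℂˣ) : ℂ) = ψ (x : IdeleClassGroup K) :=
  ⟨toHeckeCharacter K ψ, isUnitary_toHeckeCharacter K ψ,
    (hasUnitaryArchType_toHeckeCharacter_iff K ψ e).mpr hψ, coe_toHeckeCharacter_apply K ψ⟩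

end IdeleClassGroup

end Literature.NumberTheory.Automorphic

end
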